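import Summits.QuantumFields.YangMills.Theorems.BalabanUVNodesN12AtTheta13OfThm1CCMWGenericDoorWindowGuard
import Summits.QuantumFields.YangMills.Theorems.BalabanUVNodesN12AtRecord13Prop1KnitThm1OfRecord
import Summits.QuantumFields.YangMills.Theorems.BalabanUVNodesN12Prop1AssembledOfForestPackageLocOfChartLetterN

/-!
# BalabanUVNodes ∕ N12 — «12X-W v7»: the WINDOW-GUARDED N12 socket at a door below `e⁻³`, every layer letter an object of record, Prop. 1 FROM THE ASSEMBLED, LOCALISED ENDPOINT WITH THE GAUGE LETTER DISCHARGED BY NAME (forest package)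

Cell `pub-ymgap` (HUMAN RULINGS D-0062 ∕ D-0149), seat `pub-ymgap-dag-n12-d` g19 (R134 N12 [B15] s2 = by-name knit at the record); count-neutral helper of
K1⁹ `stmt-QuantumFields-27364` (`--kind proof --supports … --as helper`).  THEOREMS ONLY (0 `def`, 0 `instance`, 0 `sorry`); composition BY NAME.

WHAT.  12X-W v3 (p633631) ∕ v4 (p636370) ∕ v5 (p638661) ∕ v6 (p641052) is the kernel-certified BILL of N12's socket in the K1 closers of record (dag-n24-w1 X3 (a) p623152 ∕ dag-n24-c 42H p627106) at a
door `θ₁₅ᶜᶜᴹᵂ(j;γ;ε₀,ε₂₉;B₃,B₃',a₀,a₁)` with `γ ≤ e⁻³`.  This edition re-keys its Prop-1 rows on dag-n12-w5 g5's (vi) `…N12Prop1AssembledOfForestPackageLocOfChartLetterN` (= (v) with the ∀δ∃e gauge letter `hσN` DISCHARGED BY NAME from dag-n12-w6 g2's forest-package producer `B15Prop1GaugeLetterLocOfForestPackage` through dag-n12-w5's `B15Prop1GaugeLetterSocketOfForestPackage.hσN_of_forestPackage_linear`: displayed instead, per instance, the rooted tower-forest package `path root hF2 hwalk hpkg hcov`,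 budgets `ℓs hℓs ℓb ℓ ℓT hcapS hcapB hNcap`, the `N`-geometry `hGN hN1`, a reference guard `e₀` with moduli `cP cT cG`, the graded root-free PLAQUETTE letter at the minimiser `hP` on `S` with `hSΩ` and the ROOT-TRANSPORTER letter `hT`, both LINEAR IN THE GUARD; (v) = (iv) with dag-n12-w4's localised chart letter `chartLetter_of_letters_N` supplied INSIDE: the chart constants `ρs Cμ Cρ C₂ Cτ` and the chart body (χ)_N are no longer displayed — instead dag-n12-w4's geometry letter `hΩw` and the locality letter `hNpos : inputsPos 𝐁_k(Z) ⊆ N`)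
(LOCATED-CIN (R-a) + dag-n12-c's assembly order inside, `[Finite (ι P)]`): OFF the bill go the numerics `hsm hγle`, the Schur size, the positivity constant, the guard `eR`
(replaced by a reference guard `eR₀` at which (J0′) is read), the datum tolerance `ρn`+`hρn`, the tolerances `δc δin`+`hsmall`, and `cE cA cJ hcE hcA heRa hcJ'`; ON the
bill instead: `N` + `hNpos` + (gN1)(gN2), the forest package + budgets, the two linear letters `hP`∕`hSΩ`, `hT` (the gauge letter (σ)_N and the chart letter are supplied inside by name), dag-n12-w4's geometry letter `hΩw`, `0 < bx`; the rest = 12Zᴳ-W §2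
(p623526) verbatim (`εreg = a₀`, `M₁ = L^j ≥ 2`, `0 < a₀`, `0 < a₁` are the door's).

WHAT N12 COSTS HERE (kernel = the binder list): per in-window run with `1 ≤ K`: live-mass at the top slot · levels `N₀ ≤ Nm`, `N₀ ≤ K` · situation residual numbers · `hC` + `hMl` ·
`hβhist` · `Λ ≠ ∅` · four ℍ-leaves + (1.80); per run ∕ instance (`ι P` finite): structure ∕ boxes, (J0′) `hMin` at `eR₀`, `hΩw`, `N` + `hNpos` + `hGN hN1`, forest package `path root hF2 hwalk hpkg hcov` + budgets
`ℓs hℓs ℓb ℓ ℓT hcapS hcapB hNcap`, guard∕moduli `e₀ cP cT cG` (+ signs), plaquette letter `S hP hSΩ`, transporter letter `hT`, geometry (`hZ1 hZblk hdiv`), `hbxM hM hR h𝓐₀`; door: `hγ₀ hγh hB hB' ha₀ ha₁ hbox' hβ' hγe h15`, `1 ≤ j`.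

HONEST FRAMING ∕ LOCATED.  Bookkeeping by name; CONDITIONAL on the displayed rows; a currency edition; nothing of Bałaban's asserted; N12 NOT discharged; K0⁷ ∕ K1⁹ NOT
closed; counts unmoved; one finite 𝕋⁴ programme at fixed `ε = L^{-K}` — R4 closes only the conditional rung `BalabanLadder.UV`; no summit statement is proved here and
NOT the Yang–Mills mass gap (Clay); nothing continuum ∕ ℝ⁴ ∕ OS.

References: [Balaban1989LargeFieldI] CMP 122 (1989) 175–202; [Balaban1989LargeFieldII] CMP 122 (1989) 355–392; [Balaban1988Convergent] CMP 119 (1988) 243–285;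
[Balaban1985Variational] CMP 102 (1985) 277–309; [Balaban1987RG1] CMP 109 (1987) 249–301 (locators in the theorem docstring).
-/

noncomputable section
open MeasureTheory Set Finset Metric Filter
open scoped Matrix.Norms.L2Operator BigOperators Matrix RealInnerProductSpace Real InnerProductSpace Topology

namespace Summit.QuantumFields.YangMills.BalabanUVNodes.N12AtTheta13OfThm1CCMWGenericDoorWindowGuardPinLFAssembledForestPackageLocChartLetterN

open Literature.MathematicalPhysics.QuantumFieldTheory.Balaban1983to89
open Literature.MathematicalPhysics.QuantumFieldTheory.Balaban1983to89.T4Continuum (T4Family LStep Letter walk walkEnd netDisp holAt)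
open Literature.MathematicalPhysics.QuantumFieldTheory.Balaban1983to89.DagBinding
open Literature.MathematicalPhysics.QuantumFieldTheory.Balaban1983to89.Node00
open FlowStep (prefixOf BetaLowerH BetaUpperH)
open B15Claim189Assembly (Setting189 new189 chiPP dom half)
open B15 (Prop1Printed Ineq180)
open B15.BasicStep (Claim189)
open B15.PrelimIntegrations (Ineq191 Ineq195)
open B15Chi124DetSets (E124)
open B14DomainGeom (Pt)
open B8Eq17ClassAkV1 (plaqsOf)
open B14.Eq216Concrete (inputs)
open GaugeGroup (dist1)
open GaugeField (plaqHol gaugeAct)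
open B15Claim189PrintedConditions (omegaOfChain)
open B15Claim189PinsOfHistory (N0OfRecord₁₃)
open B15Claim189LambdaPin (enlD)
open B15RPrime1100OfRep (rPrimeDataOfSel)
open Summit.QuantumFields.YangMills.BalabanUVNodes.N12AtRecord13Prop1KnitThm1OfRecord (thm1TorusClass_of_variationalThm1RegSepCoP7M)
open Summit.QuantumFields.YangMills.BalabanUVNodes.N12AtTheta13OfThm1CCMWGenericDoorWindowGuard (exists_gamma_residW_b15Leaf_window_theta13OfThm1CCMW_topLevel_pinnedΛΩχZ_of_massLive)
open T4CubeChartGnomonic (SU2)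
open B15Prop1ChartSU2 (su2Chart)
open B15Prop1SliceCoordinates (GaugeSlice ιA)
open T4AxialGaugeSmallField (castSite boxPlaqs boxBonds)
open B6BondElimination (unitVec)
open B6TreeGaugePoincare (curl)
open B16Eq18Proof (box)
open B15Extension193 (extend)
open B15ShellGauge193 (shellGauge)
open B15Sect1Instances (fun177std)
open B14.Eq213DetSet (Bj maxDomT)
open B14.Eq213MaximalDomains (side)
open B14.Eq22Determines (blockIter IsBlockUnion)
open Literature.MathematicalPhysics.QuantumFieldTheory.BalabanImbrieJaffe1984to88.BIJ85Eq453GaugeField (qsstarGIter0)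
open B16Sect1Backgrounds (expMul toMS)
open B15DeterminingSets (pts DetBackground genSet IsMinimizer MSField avgFamily bondsOf DetSet embIter)
open B5Eq118OneStroke (iterBlockOf)
open B15Prop1Carrier (lfVarOn InstOn InstOn.std plaqsInside)
open Summit.QuantumFields.YangMills.BalabanUVNodes.N12Prop1AssembledOfForestPackageLocOfChartLetterN (exists_domain_prop1Printed_lfVarOn_std_su2_box_intrinsic_analytic_atZSeqCoPRecord_ofThm1TorusClass_ofMinimiserFamily_ofForestPackageAtTolerance_ofChartLetterN_ofCoercive)
open T4AdjointCovarianceUnitary (lieSU)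
open B15Prop1GradientFromNearValueAtCoPRecord (far_letter_of_box)
open B15Prop1AnalyticExtClause (cplxVec anExt)
open B15Prop1ChartCalculusSU2 (E3)

variable {F : T4Family}

/-! ## §2 «12X-W v7» AT THE GENERIC DOOR-CURED WINDOW-EDITION WITNESS, DOOR BELOW `e⁻³`: the window-guarded socket, every layer letter an object of record, Prop. 1 from the FULLY ASSEMBLED LOCALISED endpoint (chart letter AND gauge letter by name inside) -/

section WindowRoadPinLF
variable {j : ℕ} {γ ε₀ ε₂₉ B₃ B₃' a₀ a₁ : ℝ} (lam : ResidW F 2) (σ : ∀ P : B12.RunParams, Sit189 F 2 P.K)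
  (s : ∀ P : B12.RunParams, SeqOfRecord F (theta13OfThm1CCMW F 2 j γ ε₀ ε₂₉ B₃ B₃' a₀ a₁).ν (theta13OfThm1CCMW F 2 j γ ε₀ ε₂₉ B₃ B₃' a₀ a₁).τ9.M (gOfRecord₁₃ F 2 (theta13OfThm1CCMW F 2 j γ ε₀ ε₂₉ B₃ B₃' a₀ a₁) P) P.K (P.K - 1 + 1)) (Nm : B12.RunParams → ℕ) (p₁ : ℕ)

/-- **★★★ THE WINDOW-GUARDED N12 SOCKET AT A DOOR BELOW `e⁻³`, EVERY LETTER OF THE LAYER AN OBJECT OF RECORD, PROP. 1 FROM THE FULLY ASSEMBLED LOCALISED ENDPOINT WITH THE GAUGE LETTER DISCHARGED** —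
12X-W v6 (p641052) re-keyed on dag-n12-w5's (vi) `…N12Prop1AssembledOfForestPackageLocOfChartLetterN` (dag-n12-w4's `chartLetter_of_letters_N` AND dag-n12-w6's forest-package gauge producer via `hσN_of_forestPackage_linear` INSIDE) (LOCATED-CIN (R-a); numerics ∕ guard ∕ datum tolerance ∕ `cE cA cJ heRa` INSIDE,
`[Finite (ι P)]`): `∃ γ₁₂ > 0, ∃ lamW, ∀ P, lamW.kSel P < P.K → Step.InInterval γ₁₂ P.K (gOfRecord₁₃ F 2 θW P) → B15Leaf (WOfRecord₁₃ F 2 θW lamW P)` (the N12 binder of the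
K1 closers of record, dag-n24-w1 X3 (a) p623152 ∕ dag-n24-c 42H p627106) with `γ₁₂ := γ` and the fully pinned layer `λˣ` (`kSel := K − 1`, (1.100) := the 𝐑-step's reading,
(1.89) setting := dag-n12-e's ΛΩχZ pin displayed as `D P` by `hD`, Prop-1 carrier := `lfVarOn su2Chart (InstOn.std …)` at the radii `R P i`, LF radius at `γ := (12d)²∕(10·bx²)`,
thresholds `areg P i` PRODUCED by the endpoint).  NOT displayed: Prop. 1 (1.78), Claim (1.89), (1.100) pin, `hsel`, `hI`, `hwin`, (2.7), the chart constants ∕ (χ)_N, the gauge letter (σ)_N, the numerics, the guard, `ρn`,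
`cE cA cJ heRa hcJ'`.  Displayed per in-window run with `1 ≤ K`: live-mass at the top slot, levels, situation numbers, `hC`∕`hMl`, `hβhist`, `Λ ≠ ∅`, four ℍ-leaves + (1.80);
per run ∕ instance: structure ∕ boxes, (J0′) at `eR₀`, dag-n12-w4's `hΩw` + `hNpos`, `N` + (gN1)(gN2), the rooted tower-forest package + budgets, the plaquette letter `hP`∕`hSΩ` and the transporter letter `hT` (both linear in the guard `e ≤ e₀`), geometry; door letters `hγ₀ hγh hB hB' ha₀ ha₁ hbox' hβ' hγe h15` + `1 ≤ j`.
CONDITIONAL on the displayed rows; nothing of Bałaban asserted; N12 NOT discharged; K0⁷ ∕ K1⁹ NOT closed. [cite: Balaban1989LargeFieldI, (0.1)–(0.6) pp.175–176, (1.2) p.178, (1.74) p.192, Prop. 1 (1.77)–(1.78) p.194 («for ε > 0 sufficiently small»), (1.79)–(1.80) p.195, (1.89) p.198, (1.91)–(1.97) pp.198–199, (1.99)–(1.102) pp.200–201; Balaban1989LargeFieldII, p.357, (1.7)–(1.13) pp.358–359, (1.17)–(1.19) pp.360–361; Balaban1988Convergent, (2.1)–(2.9) pp.254–256, (2.17)–(2.18)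 p.257, (3.16)–(3.25) pp.268–270; Balaban1985Variational, Thm 1 (8) p.279, (16)–(18) p.280; Balaban1987RG1, Thm 1 p.259, (0.20) p.256] -/
theorem exists_gamma_residW_b15Leaf_window_theta13OfThm1CCMW_pinLF_pinnedΛΩχZ_of_massLive_assembledForestPackageLocChartLetterN
    (hγ₀ : 0 < γ) (hγh : γ ≤ 1 / 2) (hB : 0 ≤ B₃) (hB' : 0 ≤ B₃') (ha₀ : 0 < a₀) (ha₁ : 0 < a₁)
    {β' : ℝ} (hbox' : BetaUpperH β' γ (betaOfRecord₁₃ F 2 (theta13OfThm1CCMW F 2 j γ ε₀ ε₂₉ B₃ B₃' a₀ a₁))) (hβ' : β' * γ ^ 2 ≤ 3 / 4) (hγe : γ ≤ Real.exp (-3))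
    (D : ∀ P : B12.RunParams, Setting189 (F.P P.K) (SU 2) (MSField (F.P P.K) (SU 2) × ((j : ℕ) → VecField (F.P P.K) j (EuclideanSpace ℝ (Fin (2 ^ 2 - 1))))) (Pt (F.P P.K).d))
    (hD : ∀ P : B12.RunParams, D P = ((({ lam with kSel := fun P : B12.RunParams => P.K - 1, D1100 := fun P : B12.RunParams => rPrimeDataOfSel (reprTOfRecord₁₃ F 2 (theta13OfThm1CCMW F 2 j γ ε₀ ε₂₉ B₃ B₃' a₀ a₁) P (P.K - 1)) ((theta13OfThm1CCMW F 2 j γ ε₀ ε₂₉ B₃ B₃' a₀ a₁).ppSel P (gOfRecord₁₃ F 2 (theta13OfThm1CCMW F 2 j γ ε₀ ε₂₉ B₃ B₃' a₀ a₁) P) (P.K - 1 + 1)) (fibOfSeq F (theta13OfThm1CCMW F 2 j γ ε₀ ε₂₉ B₃ B₃' a₀ a₁).ν (theta13OfThm1CCMW F 2 j γ ε₀ ε₂₉ B₃ B₃' a₀ a₁).τ9 P (gOfRecord₁₃ F 2 (theta13OfThm1CCMW F 2 j γ ε₀ ε₂₉ B₃ B₃' a₀ a₁) P) (P.K - 1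 + 1)) } : ResidW F 2).pinRPrime₁₃ (theta13OfThm1CCMW F 2 j γ ε₀ ε₂₉ B₃ B₃' a₀ a₁)).pinD189ΛH (theta13OfThm1CCMW F 2 j γ ε₀ ε₂₉ B₃ B₃' a₀ a₁).ν (theta13OfThm1CCMW F 2 j γ ε₀ ε₂₉ B₃ B₃' a₀ a₁).A₁ (theta13OfThm1CCMW F 2 j γ ε₀ ε₂₉ B₃ B₃' a₀ a₁).τ9.M (gOfRecord₁₃ F 2 (theta13OfThm1CCMW F 2 j γ ε₀ ε₂₉ B₃ B₃' a₀ a₁)) (fun P => (((((σ P).pinZres (theta13OfThm1CCMW F 2 j γ ε₀ ε₂₉ B₃ B₃' a₀ a₁).ν (theta13OfThm1CCMW F 2 j γ ε₀ ε₂₉ B₃ B₃' a₀ a₁).τ9.M (gOfRecord₁₃ F 2 (theta13OfThm1CCMW F 2 j γ ε₀ ε₂₉ B₃ B₃' a₀ a₁) P) (s P) (N0OfRecord₁₃ (theta13OfThm1CCMW F 2 j γ ε₀ ε₂₉ B₃ B₃' a₀ a₁) P (P.K - 1 + 1))).pinSides (theta13OfThm1CCMW F 2 j γ ε₀ ε₂₉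 B₃ B₃' a₀ a₁).ν (gOfRecord₁₃ F 2 (theta13OfThm1CCMW F 2 j γ ε₀ ε₂₉ B₃ B₃' a₀ a₁) P) (P.K - 1 + 1 - Nm P) (P.K - 1 + 1)).pinXΩ4 (s P) (enlD F (theta13OfThm1CCMW F 2 j γ ε₀ ε₂₉ B₃ B₃' a₀ a₁).ν (theta13OfThm1CCMW F 2 j γ ε₀ ε₂₉ B₃ B₃' a₀ a₁).τ9.M P (gOfRecord₁₃ F 2 (theta13OfThm1CCMW F 2 j γ ε₀ ε₂₉ B₃ B₃' a₀ a₁) P))).pinOmegaPP (s P) (Nm P) (enlD F (theta13OfThm1CCMW F 2 j γ ε₀ ε₂₉ B₃ B₃' a₀ a₁).ν (theta13OfThm1CCMW F 2 j γ ε₀ ε₂₉ B₃ B₃' a₀ a₁).τ9.M P (gOfRecord₁₃ F 2 (theta13OfThm1CCMW F 2 j γ ε₀ ε₂₉ B₃ B₃' a₀ a₁) P)))) s Nm p₁).D189 P)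
    (hmassLive : ∀ P : B12.RunParams, 1 ≤ P.K → Step.InInterval γ P.K (gOfRecord₁₃ F 2 (theta13OfThm1CCMW F 2 j γ ε₀ ε₂₉ B₃ B₃' a₀ a₁) P) → ∀ a, LiveSeq F 2 (theta13OfThm1CCMW F 2 j γ ε₀ ε₂₉ B₃ B₃' a₀ a₁).ν (theta13OfThm1CCMW F 2 j γ ε₀ ε₂₉ B₃ B₃' a₀ a₁).τ9 P (gOfRecord₁₃ F 2 (theta13OfThm1CCMW F 2 j γ ε₀ ε₂₉ B₃ B₃' a₀ a₁) P) (P.K - 1 + 1)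
        (slotsTOfRecord F 2 (theta13OfThm1CCMW F 2 j γ ε₀ ε₂₉ B₃ B₃' a₀ a₁).ν (theta13OfThm1CCMW F 2 j γ ε₀ ε₂₉ B₃ B₃' a₀ a₁).τ9 (EOfRecord₁₃ F 2 (theta13OfThm1CCMW F 2 j γ ε₀ ε₂₉ B₃ B₃' a₀ a₁)) (wOfRecord₉ F 2 (theta13OfThm1CCMW F 2 j γ ε₀ ε₂₉ B₃ B₃' a₀ a₁).toStage9Params)
          (theta13OfThm1CCMW F 2 j γ ε₀ ε₂₉ B₃ B₃' a₀ a₁).ppSel P (gOfRecord₁₃ F 2 (theta13OfThm1CCMW F 2 j γ ε₀ ε₂₉ B₃ B₃' a₀ a₁) P) (P.K - 1 + 1)) a →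
      0 < ∫ V, rterm (reprTOfRecord₁₃ F 2 (theta13OfThm1CCMW F 2 j γ ε₀ ε₂₉ B₃ B₃' a₀ a₁) P (P.K - 1)) a V ∂(fieldMeasure (F.P P.K) (P.K - 1 + 1) (SU 2)))
    (hNN : ∀ P : B12.RunParams, 1 ≤ P.K → Step.InInterval γ P.K (gOfRecord₁₃ F 2 (theta13OfThm1CCMW F 2 j γ ε₀ ε₂₉ B₃ B₃' a₀ a₁) P) → N0OfRecord₁₃ (theta13OfThm1CCMW F 2 j γ ε₀ ε₂₉ B₃ B₃' a₀ a₁) P (P.K - 1 + 1) ≤ Nm P)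
    (hNk : ∀ P : B12.RunParams, 1 ≤ P.K → Step.InInterval γ P.K (gOfRecord₁₃ F 2 (theta13OfThm1CCMW F 2 j γ ε₀ ε₂₉ B₃ B₃' a₀ a₁) P) → N0OfRecord₁₃ (theta13OfThm1CCMW F 2 j γ ε₀ ε₂₉ B₃ B₃' a₀ a₁) P (P.K - 1 + 1) ≤ P.K - 1 + 1)
    (hβ0 : ∀ P : B12.RunParams, 1 ≤ P.K → Step.InInterval γ P.K (gOfRecord₁₃ F 2 (theta13OfThm1CCMW F 2 j γ ε₀ ε₂₉ B₃ B₃' a₀ a₁) P) → 0 ≤ (σ P).β)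
    (hβ : ∀ P : B12.RunParams, 1 ≤ P.K → Step.InInterval γ P.K (gOfRecord₁₃ F 2 (theta13OfThm1CCMW F 2 j γ ε₀ ε₂₉ B₃ B₃' a₀ a₁) P) → (σ P).β ≤ 1 / 4)
    (hL₀ : ∀ P : B12.RunParams, 1 ≤ P.K → Step.InInterval γ P.K (gOfRecord₁₃ F 2 (theta13OfThm1CCMW F 2 j γ ε₀ ε₂₉ B₃ B₃' a₀ a₁) P) → 2 ≤ (σ P).L₀)
    (hL₀L : ∀ P : B12.RunParams, 1 ≤ P.K → Step.InInterval γ P.K (gOfRecord₁₃ F 2 (theta13OfThm1CCMW F 2 j γ ε₀ ε₂₉ B₃ B₃' a₀ a₁) P) → (σ P).L₀ ^ 2 ≤ ((F.P P.K).L : ℝ))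
    (hOB : ∀ P : B12.RunParams, 1 ≤ P.K → Step.InInterval γ P.K (gOfRecord₁₃ F 2 (theta13OfThm1CCMW F 2 j γ ε₀ ε₂₉ B₃ B₃' a₀ a₁) P) → 0 ≤ (σ P).O1 * (σ P).B₃ * (σ P).B₅)
    (hδ : ∀ P : B12.RunParams, 1 ≤ P.K → Step.InInterval γ P.K (gOfRecord₁₃ F 2 (theta13OfThm1CCMW F 2 j γ ε₀ ε₂₉ B₃ B₃' a₀ a₁) P) → 0 ≤ (σ P).δ)
    (hC : ∀ P : B12.RunParams, 1 ≤ P.K → Step.InInterval γ P.K (gOfRecord₁₃ F 2 (theta13OfThm1CCMW F 2 j γ ε₀ ε₂₉ B₃ B₃' a₀ a₁) P) →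
      4 * (2 + (121 / 120) ^ 2 * ((σ P).O1 * (σ P).B₃ * (σ P).B₅ * ((theta13OfThm1CCMW F 2 j γ ε₀ ε₂₉ B₃ B₃' a₀ a₁).τ9.M : ℝ) ^ 5)) ≤ (Real.log (γ ^ 2)⁻¹) ^ (Real.log ((σ P).L₀ ^ 2) / Real.log ((F.P P.K).L : ℝ)))
    (hβhist : ∀ P : B12.RunParams, 1 ≤ P.K → Step.InInterval γ P.K (gOfRecord₁₃ F 2 (theta13OfThm1CCMW F 2 j γ ε₀ ε₂₉ B₃ B₃' a₀ a₁) P) → ∀ i, i < P.K - 1 + 1 → 0 ≤ betaOfRecord₁₃ F 2 (theta13OfThm1CCMW F 2 j γ ε₀ ε₂₉ B₃ B₃' a₀ a₁) i (prefixOf (gOfRecord₁₃ F 2 (theta13OfThm1CCMW F 2 j γ ε₀ ε₂₉ B₃ B₃' a₀ a₁) P) i))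
    (hMl : ∀ P : B12.RunParams, 1 ≤ P.K → Step.InInterval γ P.K (gOfRecord₁₃ F 2 (theta13OfThm1CCMW F 2 j γ ε₀ ε₂₉ B₃ B₃' a₀ a₁) P) → (121 / 120) ^ 2 * ((σ P).O1 * (σ P).B₃ * (σ P).B₅ * ((theta13OfThm1CCMW F 2 j γ ε₀ ε₂₉ B₃ B₃' a₀ a₁).τ9.M : ℝ) ^ 5) * Real.exp (-(4 * (σ P).δ * ((theta13OfThm1CCMW F 2 j γ ε₀ ε₂₉ B₃ B₃' a₀ a₁).τ9.M : ℝ))) ≤ 1 / 12)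
    (hΛ : ∀ P : B12.RunParams, 1 ≤ P.K → Step.InInterval γ P.K (gOfRecord₁₃ F 2 (theta13OfThm1CCMW F 2 j γ ε₀ ε₂₉ B₃ B₃' a₀ a₁) P) → (((enlD F (theta13OfThm1CCMW F 2 j γ ε₀ ε₂₉ B₃ B₃' a₀ a₁).ν (theta13OfThm1CCMW F 2 j γ ε₀ ε₂₉ B₃ B₃' a₀ a₁).τ9.M P (gOfRecord₁₃ F 2 (theta13OfThm1CCMW F 2 j γ ε₀ ε₂₉ B₃ B₃' a₀ a₁) P)) 4 (P.K - 1 + 1 + 1 - (N0OfRecord₁₃ (theta13OfThm1CCMW F 2 j γ ε₀ ε₂₉ B₃ B₃' a₀ a₁) P (P.K - 1 + 1)))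
        (omegaOfChain (s P) (P.K - 1 + 1 + 1 - (N0OfRecord₁₃ (theta13OfThm1CCMW F 2 j γ ε₀ ε₂₉ B₃ B₃' a₀ a₁) P (P.K - 1 + 1)))))ᶜ ∩ (σ P).Z).Nonempty)
    (L91h : ∀ P : B12.RunParams, 1 ≤ P.K → Step.InInterval γ P.K (gOfRecord₁₃ F 2 (theta13OfThm1CCMW F 2 j γ ε₀ ε₂₉ B₃ B₃' a₀ a₁) P) → ∀ U, new189 (D P) U → ∀ p ∈ plaqsOf (half (D P)),
      Ineq191 (dist1 (plaqHol ((D P).Upp U) p)) ((D P).devV'' U p) (D P).α (((D P).L ^ (D P).h)⁻¹) ((D P).ε (D P).h) (E124 (D P).ε (D P).L (D P).η (D P).k (D P).h))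
    (L95 : ∀ P : B12.RunParams, 1 ≤ P.K → Step.InInterval γ P.K (gOfRecord₁₃ F 2 (theta13OfThm1CCMW F 2 j γ ε₀ ε₂₉ B₃ B₃' a₀ a₁) P) → ∀ U, new189 (D P) U → ∀ p ∈ plaqsOf (half (D P)),
      Ineq195 ((D P).devV'' U p) (dist1 (plaqHol ((D P).Uhalf U ((D P).boxOf p)) p)) (D P).α (((D P).L ^ (D P).h)⁻¹) ((D P).ε (D P).h) (E124 (D P).ε (D P).L (D P).η (D P).k (D P).h))
    (L91 : ∀ P : B12.RunParams, 1 ≤ P.K → Step.InInterval γ P.K (gOfRecord₁₃ F 2 (theta13OfThm1CCMW F 2 j γ ε₀ ε₂₉ B₃ B₃' a₀ a₁) P) → ∀ U, new189 (D P) U → ∀ i, (D P).h ≤ i → i ≤ (D P).k → ∀ p ∈ plaqsOf (dom (D P) i),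
      Ineq191 (dist1 (plaqHol ((D P).Upp U) p)) ((D P).dev97 U p) (D P).α (((D P).L ^ i)⁻¹) ((D P).ε i) (E124 (D P).ε (D P).L (D P).η (D P).k i))
    (L97 : ∀ P : B12.RunParams, 1 ≤ P.K → Step.InInterval γ P.K (gOfRecord₁₃ F 2 (theta13OfThm1CCMW F 2 j γ ε₀ ε₂₉ B₃ B₃' a₀ a₁) P) → ∀ U, new189 (D P) U → ∀ i, (D P).h ≤ i → i ≤ (D P).k → ∀ p ∈ plaqsOf (dom (D P) i),
      Ineq191 ((D P).dev97 U p) ((D P).dev0 U p) (D P).α (((D P).L ^ i)⁻¹) ((D P).ε i) (E124 (D P).ε (D P).L (D P).η (D P).k i))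
    (L80 : ∀ P : B12.RunParams, 1 ≤ P.K → Step.InInterval γ P.K (gOfRecord₁₃ F 2 (theta13OfThm1CCMW F 2 j γ ε₀ ε₂₉ B₃ B₃' a₀ a₁) P) → ∀ U, new189 (D P) U → ∀ i, (D P).h ≤ i → i ≤ (D P).k → ∀ p ∈ plaqsOf (dom (D P) i),
      Ineq180 ((D P).dev0 U p) ((D P).ε (D P).k) (D P).η (D P).B₃ (D P).B₅ (D P).M (D P).δ ((D P).dist p) (D P).O1)
    -- dag-n12-w5's ASSEMBLED LOCALISED endpoint's letters ON THE RUN's LATTICE, per run `P` and FINITE instance family `ι P`: structure ∕ region boxes ∕ (J0′) at a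
    -- REFERENCE guard ∕ forest package + budgets + `N`-geometry + the two letters linear in the guard ((σ)_N by name inside) ∕ `hΩw` ((χ)_N by name inside) ∕ geometry — numerics, guard, tolerances INSIDE
    (hd3 : ∀ P : B12.RunParams, 3 ≤ (F.P P.K).d) (h0 : ∀ P : B12.RunParams, 0 < (F.P P.K).d) (ι : B12.RunParams → Type) [hfin : ∀ P : B12.RunParams, Finite (ι P)]
    (Z Λ : ∀ P : B12.RunParams, ι P → Set (Site (F.P P.K) 0)) (k : ∀ P : B12.RunParams, ι P → ℕ) (M : ∀ P : B12.RunParams, ι P → ℝ) (hk0 : ∀ P i, 0 < k P i) (hk : ∀ P i, k P i ≤ (F.P P.K).m + (F.P P.K).K)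
    -- the REFERENCE guard per instance (the guard of the row is chosen below it, inside the endpoint)
    (eR₀ : ∀ P : B12.RunParams, ι P → ℝ) (heR₀ : ∀ P i, 0 < eR₀ P i)
    (T : ∀ (P : B12.RunParams) (i : ι P), Finset (PBond (F.P P.K) (k P i)))
    (lo hi : ∀ P : B12.RunParams, ι P → Fin (F.P P.K).d → ℤ) (n : ∀ P : B12.RunParams, ι P → ℕ) (hn : ∀ P i κ, hi P i κ ≤ lo P i κ + n P i) (hN : ∀ P i, n P i + 2 < (F.P P.K).sitesPerDir (k P i))
    (hbox : ∀ P i, pts (k P i) (Λ P i) = (castSite '' Set.Icc (lo P i) (hi P i) : Set (Site (F.P P.K) (k P i))))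
    (hZ : ∀ P i, (boxPlaqs (lo P i - 1) (hi P i + 1) : Set (Plaq (F.P P.K) (k P i))) ⊆ plaqsInside (pts (k P i) (Z P i)))
    (hTG0 : ∀ P i, T P i = (box (fun κ => (hi P i κ - lo P i κ + 1).toNat) (lo P i)).image fun x =>
      (⟨castSite (x - unitVec ⟨0, h0 P⟩), ⟨0, h0 P⟩⟩ : PBond (F.P P.K) (k P i)))
    (hN5 : ∀ P i κ, ((hi P i κ - lo P i κ + 1).toNat : ℤ) + 5 < (F.P P.K).sitesPerDir (k P i))
    (ext : ∀ (P : B12.RunParams) (i : ι P), GaugeField (F.P P.K) (k P i) SU2 → GaugeField (F.P P.K) (k P i) SU2)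
    (hext : ∀ P i Vk, ext P i Vk = extend (pts (k P i) (Λ P i)) (shellGauge Vk (lo P i) (hi P i)) Vk)
    (hlohi : ∀ P i, lo P i ≤ hi P i)
    -- the REGION parallelepipeds of the normalisation (the datum tolerances are chosen inside, linear in the guard)
    (LO HI : ∀ P : B12.RunParams, ι P → Fin (F.P P.K).d → ℤ) (hLO : ∀ P i, LO P i ≤ lo P i - 1) (hHI : ∀ P i, hi P i + 1 ≤ HI P i) (n' : ∀ P : B12.RunParams, ι P → ℕ) (hn' : ∀ P i κ, HI P i κ ≤ LO P i κ + n' P i)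
    (hn'N : ∀ P i, n' P i < (F.P P.K).sitesPerDir (k P i)) (hR' : ∀ P i, (boxPlaqs (LO P i) (HI P i) : Set (Plaq (F.P P.K) (k P i))) ⊆ plaqsInside (pts (k P i) (Z P i)))
    {bx : B12.RunParams → ℝ} (hbx : ∀ P, 0 < bx P)
    (hbxM : ∀ P i, 12 * ((F.P P.K).d : ℝ) * ((n P i : ℝ) + 2) ^ 2 ≤ bx P * (M P i) ^ 2)
    {R 𝓐₀ : ∀ P : B12.RunParams, ι P → ℝ} (hM : ∀ P i, 1 ≤ (M P i)) (hR : ∀ P i, 0 < R P i)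
    -- (J0′), R-EXPLICIT, AT THE REFERENCE GUARD `eR₀`: per instance one radius and one bound for every base field of the strict guard
    (hMin : ∀ P i Vk, PlaqSmallOn (plaqsInside (pts (k P i) (Z P i ∩ (Λ P i)ᶜ))) (eR₀ P i) Vk →
      ∃ Ũ : VecField (F.P P.K) (k P i) (EuclideanSpace ℂ (Fin 3)) × VecField (F.P P.K) (k P i) (EuclideanSpace ℂ (Fin 3)) →
          PBond (F.P P.K) 0 → Matrix (Fin 2) (Fin 2) ℂ,
        (∀ b a c, DifferentiableOn ℂ (fun z => Ũ z b a c) (ball 0 (R P i))) ∧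
        (∀ z ∈ ball (0 : VecField (F.P P.K) (k P i) (EuclideanSpace ℂ (Fin 3)) × VecField (F.P P.K) (k P i) (EuclideanSpace ℂ (Fin 3))) (R P i),
          ∀ b a c, ‖Ũ z b a c‖ ≤ 𝓐₀ P i) ∧
        ∀ p B' : VecField (F.P P.K) (k P i) E3, ‖p‖ < R P i → ‖B'‖ < R P i → ∃ U' : GaugeField (F.P P.K) 0 SU2,
          (∀ b, Ũ (cplxVec p, cplxVec B') b = ((U' b : SU2) : Matrix (Fin 2) (Fin 2) ℂ)) ∧
            IsMinimizer (Node00.avOfRecord F 2 P.K) (Node00.regMSCoPOfRecord F 2 (theta13OfThm1CCMW F 2 j γ ε₀ ε₂₉ B₃ B₃' a₀ a₁).ν P.K (k P i) (maxDomT (theta13OfThm1CCMW F 2 j γ ε₀ ε₂₉ B₃ B₃' a₀ a₁).ν.M₁ (Z P i))) (Bj (theta13OfThm1CCMW F 2 j γ ε₀ ε₂₉ B₃ B₃' a₀ a₁).ν.M₁ (Z P i) (k P i))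
              (avgFamily (Node00.avOfRecord F 2 P.K) (qsstarGIter0 (k P i) (expMul su2Chart B' (ext P i (expMul su2Chart p Vk))))) U')
    (h𝓐₀ : ∀ P i, 0 ≤ 𝓐₀ P i)
    -- LOCATED-CIN (R-a): per instance the bond neighbourhood on which the `inputs` near-flatness is delivered ∕ asked, with dag-n12-w4's ONE locality letter on it
    (N : ∀ P : B12.RunParams, ι P → Set (PBond (F.P P.K) 0)) (hNpos : ∀ P i, B14.Eq12InteriorLocality.inputsPos (Bj (theta13OfThm1CCMW F 2 j γ ε₀ ε₂₉ B₃ B₃' a₀ a₁).ν.M₁ (Z P i) (k P i) : DetSet (F.P P.K)) ⊆ N P i)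
    -- (σ)_N DISCHARGED BY NAME (dag-n12-w5's (vi) over dag-n12-w6's forest-package producer `exists_gaugeLetterLoc_atRecord_of_forestPackage` and `hσN_of_forestPackage_linear`):
    -- per run ∕ instance the rooted tower-forest package of `𝐁_k(Z)` (dag-n12-w3's `exists_towerForest_rooted_Bj` by shape), budgets, the `N`-geometry (gN1)(gN2), a reference
    -- guard with moduli, and the two DISPLAYED letters LINEAR IN THE GUARD: the graded root-free plaquette letter at the minimiser ((1.7) ∕ [15] Thm 1) and the root-transporter letter ([15] (16)–(18))
    (path : ∀ P : B12.RunParams, ι P → Site (F.P P.K) 0 → List (LStep (F.P P.K) 0)) (root : ∀ P : B12.RunParams, ι P → Site (F.P P.K) 0 → Site (F.P P.K) 0)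
    (hF2 : ∀ (P : B12.RunParams) (i : ι P), ∀ l, l ≤ (k P i) → ∀ c ∈ bondsOf (Bj (theta13OfThm1CCMW F 2 j γ ε₀ ε₂₉ B₃ B₃' a₀ a₁).ν.M₁ (Z P i) (k P i) l), (path P i) (embIter l c.src) = [] ∧ (path P i) (embIter l c.tgt) = [])
    (hwalk : ∀ (P : B12.RunParams) (i : ι P), ∀ x, (path P i) x = walk ((root P i) x) (((path P i) x).map fun s => (s.bond.dir, s.fwd)) ∧
      walkEnd ((root P i) x) (((path P i) x).map fun s => (s.bond.dir, s.fwd)) = x)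
    (hpkg : ∀ (P : B12.RunParams) (i : ι P), ∀ (z : Site (F.P P.K) 0) (l : ℕ), l ≤ (k P i) →
      embIter l (iterBlockOf l z) ∈ {z : Site (F.P P.K) 0 | ∃ l', l' ≤ (k P i) ∧ ∃ c ∈ bondsOf ((Bj (theta13OfThm1CCMW F 2 j γ ε₀ ε₂₉ B₃ B₃' a₀ a₁).ν.M₁ (Z P i) (k P i) : DetSet (F.P P.K)) l'), (z = embIter l' c.src ∨ z = embIter l' c.tgt)} →
      (∀ s ∈ (path P i) z, iterBlockOf l s.bond.src = iterBlockOf l z ∧ iterBlockOf l s.bond.tgt = iterBlockOf l z) ∧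
      ((path P i) z).length ≤ ∑ i ∈ Finset.range (l + 1), ((F.P P.K).d * (((F.P P.K).L ^ i - 1) / 2) + 1) ∧
      (∀ ν', netDisp (((path P i) z).map fun s => (s.bond.dir, s.fwd)) ν' = ((z ν').val : ℤ) - (((root P i) z ν').val : ℤ)) ∧
      iterBlockOf l ((root P i) z) = iterBlockOf l z)
    (hcov : ∀ (P : B12.RunParams) (i : ι P), ∀ z : Site (F.P P.K) 0, ∃ J, J ≤ (k P i) ∧ iterBlockOf J z ∈ (Bj (theta13OfThm1CCMW F 2 j γ ε₀ ε₂₉ B₃ B₃' a₀ a₁).ν.M₁ (Z P i) (k P i) : DetSet (F.P P.K)) J)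
    -- budgets: per-site word bounds, per-bond transporter bounds, uniform caps (no wrapping)
    (ℓs : ∀ P : B12.RunParams, ι P → Site (F.P P.K) 0 → ℕ) (hℓs : ∀ (P : B12.RunParams) (i : ι P), ∀ x ∈ maxDomT (theta13OfThm1CCMW F 2 j γ ε₀ ε₂₉ B₃ B₃' a₀ a₁).ν.M₁ (Z P i) 1, (path P i x).length ≤ ℓs P i x)
    (ℓb : ∀ P : B12.RunParams, ι P → PBond (F.P P.K) 0 → ℕ) (ℓ ℓT : ∀ P : B12.RunParams, ι P → ℕ) (hcapS : ∀ (P : B12.RunParams) (i : ι P), ∀ x ∈ maxDomT (theta13OfThm1CCMW F 2 j γ ε₀ ε₂₉ B₃ B₃' a₀ a₁).ν.M₁ (Z P i) 1, ℓs P i x ≤ ℓ P i)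
    (hcapB : ∀ (P : B12.RunParams) (i : ι P), ∀ b : PBond (F.P P.K) 0, b.src ∈ maxDomT (theta13OfThm1CCMW F 2 j γ ε₀ ε₂₉ B₃ B₃' a₀ a₁).ν.M₁ (Z P i) 1 → b.tgt ∈ maxDomT (theta13OfThm1CCMW F 2 j γ ε₀ ε₂₉ B₃ B₃' a₀ a₁).ν.M₁ (Z P i) 1 → ℓb P i b ≤ ℓT P i) (hNcap : ∀ (P : B12.RunParams) (i : ι P), 2 * ℓ P i + 1 + ℓT P i < (F.P P.K).sitesPerDir 0)
    -- geometry of the neighbourhood `N i` ((gN1) at the region box, (gN2))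
    (hGN : ∀ (P : B12.RunParams) (i : ι P), ∀ b ∈ (N P i), (b.src ∉ maxDomT (theta13OfThm1CCMW F 2 j γ ε₀ ε₂₉ B₃ B₃' a₀ a₁).ν.M₁ (Z P i) 1 ∨ b.tgt ∉ maxDomT (theta13OfThm1CCMW F 2 j γ ε₀ ε₂₉ B₃ B₃' a₀ a₁).ν.M₁ (Z P i) 1) → B14.Eq22Determines.blockIter (k P i) b.tgt ≠ B14.Eq22Determines.blockIter (k P i) b.src →
      (⟨B14.Eq22Determines.blockIter (k P i) b.src, b.dir⟩ : PBond (F.P P.K) (k P i)) ∈ (boxBonds (LO P i) (HI P i) : Set (PBond (F.P P.K) (k P i))))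
    (hN1 : ∀ (P : B12.RunParams) (i : ι P), ∀ p : Plaq (F.P P.K) 0, ((⟨p.src, p.μ⟩ : PBond (F.P P.K) 0) ∈ {b : PBond (F.P P.K) 0 | b.src ∈ maxDomT (theta13OfThm1CCMW F 2 j γ ε₀ ε₂₉ B₃ B₃' a₀ a₁).ν.M₁ (Z P i) 1} ∨
        (⟨p.src.shift p.μ, p.ν⟩ : PBond (F.P P.K) 0) ∈ {b : PBond (F.P P.K) 0 | b.src ∈ maxDomT (theta13OfThm1CCMW F 2 j γ ε₀ ε₂₉ B₃ B₃' a₀ a₁).ν.M₁ (Z P i) 1} ∨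
        (⟨p.src.shift p.ν, p.μ⟩ : PBond (F.P P.K) 0) ∈ {b : PBond (F.P P.K) 0 | b.src ∈ maxDomT (theta13OfThm1CCMW F 2 j γ ε₀ ε₂₉ B₃ B₃' a₀ a₁).ν.M₁ (Z P i) 1} ∨
        (⟨p.src, p.ν⟩ : PBond (F.P P.K) 0) ∈ {b : PBond (F.P P.K) 0 | b.src ∈ maxDomT (theta13OfThm1CCMW F 2 j γ ε₀ ε₂₉ B₃ B₃' a₀ a₁).ν.M₁ (Z P i) 1}) →
      (⟨p.src, p.μ⟩ : PBond (F.P P.K) 0) ∈ (N P i) ∧ (⟨p.src.shift p.μ, p.ν⟩ : PBond (F.P P.K) 0) ∈ (N P i) ∧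
        (⟨p.src.shift p.ν, p.μ⟩ : PBond (F.P P.K) 0) ∈ (N P i) ∧ (⟨p.src, p.ν⟩ : PBond (F.P P.K) 0) ∈ (N P i))
    -- the reference guard and the LINEAR budgets of the two displayed letters
    (e₀ cP cT cG : ∀ P : B12.RunParams, ι P → ℝ) (he₀ : ∀ (P : B12.RunParams) (i : ι P), 0 < e₀ P i) (hcP : ∀ (P : B12.RunParams) (i : ι P), 0 ≤ cP P i) (hcT : ∀ (P : B12.RunParams) (i : ι P), 0 ≤ cT P i) (hcG : ∀ (P : B12.RunParams) (i : ι P), 0 ≤ cG P i)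
    -- DISPLAYED, LINEAR IN THE GUARD: the graded root-free plaquette letter ((1.7) ∕ [15] Thm 1 at the minimiser) on `S`, for every guarded base field and every minimiser
    (S : ∀ P : B12.RunParams, ι P → Set (Plaq (F.P P.K) 0))
    (hP : ∀ (P : B12.RunParams) (i : ι P), ∀ e : ℝ, 0 < e → e ≤ (e₀ P i) → ∀ (Vk : GaugeField (F.P P.K) (k P i) SU2), PlaqSmallOn (plaqsInside (pts (k P i) ((Z P i) ∩ (Λ P i)ᶜ))) e Vk →
      (∀ b ∈ (boxBonds (LO P i) (HI P i) : Set (PBond (F.P P.K) (k P i))), dist1 ((ext P i) Vk b) ≤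
        (((F.P P.K).d : ℝ) * (n' P i) + 1) * ((((F.P P.K).d - 1 : ℕ) : ℝ) * (n' P i) * ((12 * (F.P P.K).d * ((n P i) + 2) ^ 2 + 1) * e) + 3 * (F.P P.K).d * ((n P i) + 2) ^ 2 * e)) →
      ∀ U₀ : GaugeField (F.P P.K) 0 SU2,
        IsMinimizer (Node00.avOfRecord F 2 P.K) (Node00.regMSCoPOfRecord F 2 (theta13OfThm1CCMW F 2 j γ ε₀ ε₂₉ B₃ B₃' a₀ a₁).ν P.K (k P i) (maxDomT (theta13OfThm1CCMW F 2 j γ ε₀ ε₂₉ B₃ B₃' a₀ a₁).ν.M₁ (Z P i))) (Bj (theta13OfThm1CCMW F 2 j γ ε₀ ε₂₉ B₃ B₃' a₀ a₁).ν.M₁ (Z P i) (k P i))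
          (avgFamily (Node00.avOfRecord F 2 P.K) (qsstarGIter0 (k P i) ((ext P i) Vk))) U₀ →
        PlaqSmallOn (S P i) ((cP P i) * e) U₀)
    (hSΩ : ∀ (P : B12.RunParams) (i : ι P), ∀ b : PBond (F.P P.K) 0, b.src ∈ maxDomT (theta13OfThm1CCMW F 2 j γ ε₀ ε₂₉ B₃ B₃' a₀ a₁).ν.M₁ (Z P i) 1 → b.tgt ∈ maxDomT (theta13OfThm1CCMW F 2 j γ ε₀ ε₂₉ B₃ B₃' a₀ a₁).ν.M₁ (Z P i) 1 →
      (boxPlaqs (fun κ => ((b.src κ).val : ℤ) - (((2 * max ((ℓs P i) b.src) ((ℓs P i) b.tgt) + 1 + (ℓb P i) b) + (ℓs P i) b.src : ℕ) : ℤ))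
          (fun κ => ((b.src κ).val : ℤ) + (((2 * max ((ℓs P i) b.src) ((ℓs P i) b.tgt) + 1 + (ℓb P i) b) + (ℓs P i) b.src : ℕ) : ℤ) + 2) : Set (Plaq (F.P P.K) 0)) ⊆ (S P i))
    -- DISPLAYED, LINEAR IN THE GUARD: the root-transporter letter ([15] (16)–(18) between the points of `𝔅_k`), for every guarded base field and every minimiser
    (hT : ∀ (P : B12.RunParams) (i : ι P), ∀ e : ℝ, 0 < e → e ≤ (e₀ P i) → ∀ (Vk : GaugeField (F.P P.K) (k P i) SU2), PlaqSmallOn (plaqsInside (pts (k P i) ((Z P i) ∩ (Λ P i)ᶜ))) e Vk →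
      (∀ b ∈ (boxBonds (LO P i) (HI P i) : Set (PBond (F.P P.K) (k P i))), dist1 ((ext P i) Vk b) ≤
        (((F.P P.K).d : ℝ) * (n' P i) + 1) * ((((F.P P.K).d - 1 : ℕ) : ℝ) * (n' P i) * ((12 * (F.P P.K).d * ((n P i) + 2) ^ 2 + 1) * e) + 3 * (F.P P.K).d * ((n P i) + 2) ^ 2 * e)) →
      ∀ U₀ : GaugeField (F.P P.K) 0 SU2,
        IsMinimizer (Node00.avOfRecord F 2 P.K) (Node00.regMSCoPOfRecord F 2 (theta13OfThm1CCMW F 2 j γ ε₀ ε₂₉ B₃ B₃' a₀ a₁).ν P.K (k P i) (maxDomT (theta13OfThm1CCMW F 2 j γ ε₀ ε₂₉ B₃ B₃' a₀ a₁).ν.M₁ (Z P i))) (Bj (theta13OfThm1CCMW F 2 j γ ε₀ ε₂₉ B₃ B₃' a₀ a₁).ν.M₁ (Z P i) (k P i))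
          (avgFamily (Node00.avOfRecord F 2 P.K) (qsstarGIter0 (k P i) ((ext P i) Vk))) U₀ →
        ∀ b : PBond (F.P P.K) 0, b.src ∈ maxDomT (theta13OfThm1CCMW F 2 j γ ε₀ ε₂₉ B₃ B₃' a₀ a₁).ν.M₁ (Z P i) 1 → b.tgt ∈ maxDomT (theta13OfThm1CCMW F 2 j γ ε₀ ε₂₉ B₃ B₃' a₀ a₁).ν.M₁ (Z P i) 1 → (root P i) b.src ≠ (root P i) b.tgt →
          ∃ (Ωw : List (Letter (F.P P.K).d)) (g : SU2), walkEnd ((root P i) b.src) Ωw = (root P i) b.tgt ∧ Ωw.length ≤ (ℓb P i) b ∧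
            dist1 (holAt U₀ (walk ((root P i) b.src) Ωw) * g⁻¹) ≤ (cT P i) * e ∧ dist1 g ≤ (cG P i) * e)
    -- dag-n12-w4's GEOMETRY letter of the chart file (its chart constants and the localised chart body (χ)_N are supplied INSIDE the endpoint, from `chartLetter_of_letters_N`)
    (hΩw : ∀ P i, ∀ (ν' : Fin (F.P P.K).d), ∀ z ∈ box (fun κ => (hi P i κ - lo P i κ + 1).toNat + 3) (fun κ => lo P i κ - 2),
      (castSite z : Site (F.P P.K) (k P i)) ∈ pts (k P i) (maxDomT (theta13OfThm1CCMW F 2 j γ ε₀ ε₂₉ B₃ B₃' a₀ a₁).ν.M₁ (Z P i) (k P i)) ∧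
        (castSite z : Site (F.P P.K) (k P i)).shift ⟨0, h0 P⟩ ∈ pts (k P i) (maxDomT (theta13OfThm1CCMW F 2 j γ ε₀ ε₂₉ B₃ B₃' a₀ a₁).ν.M₁ (Z P i) (k P i)) ∧
        (castSite z : Site (F.P P.K) (k P i)).shift ν' ∈ pts (k P i) (maxDomT (theta13OfThm1CCMW F 2 j γ ε₀ ε₂₉ B₃ B₃' a₀ a₁).ν.M₁ (Z P i) (k P i)))
    -- the geometric letter: every fine site whose k-block label lies in the box `[lo − 1, hi + 1]` lies in `Ω₁(Z)` (print: `Λ` deep inside `Z`); dag-n12-c's `far_letter_of_box` turns it into the bond letter `hfar`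
    (hZ1 : ∀ P i (y : Site (F.P P.K) 0), B14.Eq22Determines.blockIter (k P i) y ∈ (castSite '' Set.Icc (lo P i - 1) (hi P i + 1) : Set (Site (F.P P.K) (k P i))) → y ∈ maxDomT (theta13OfThm1CCMW F 2 j γ ε₀ ε₂₉ B₃ B₃' a₀ a₁).ν.M₁ (Z P i) 1)
    (hZblk : ∀ P i, IsBlockUnion (k P i) (Z P i))
    (hdiv : ∀ P i, side (F.P P.K).L (theta13OfThm1CCMW F 2 j γ ε₀ ε₂₉ B₃ B₃' a₀ a₁).ν.M₁ (k P i) ∣ (F.P P.K).sitesPerDir 0)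
    (h15 : VariationalThm1RegSepCoP7M F 2 B₃ a₀ a₁) (hj : 1 ≤ j) :
    ∃ γ₁₂ : ℝ, 0 < γ₁₂ ∧ ∃ lamW : ResidW F 2, ∀ P : B12.RunParams, lamW.kSel P < P.K → Step.InInterval γ₁₂ P.K (gOfRecord₁₃ F 2 (theta13OfThm1CCMW F 2 j γ ε₀ ε₂₉ B₃ B₃' a₀ a₁) P) →
        B15Leaf (WOfRecord₁₃ F 2 (theta13OfThm1CCMW F 2 j γ ε₀ ε₂₉ B₃ B₃' a₀ a₁) lamW P) := by
  -- `2 ≤ M₁ = L^j` at the window-edition witness (`1 ≤ j`, `1 < L`); `εreg = a₀` (`rfl`)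
  have h2 : 2 ≤ F.L ^ j :=
    calc 2 ≤ F.L := F.hL.2
      _ = F.L ^ 1 := (pow_one _).symm
      _ ≤ F.L ^ j := Nat.pow_le_pow_right (Nat.zero_lt_of_lt F.hL.2) hj
  choose areg ha hP using fun P : B12.RunParams =>
    exists_domain_prop1Printed_lfVarOn_std_su2_box_intrinsic_analytic_atZSeqCoPRecord_ofThm1TorusClass_ofMinimiserFamily_ofForestPackageAtTolerance_ofChartLetterN_ofCoercive (F := F) (theta13OfThm1CCMW F 2 j γ ε₀ ε₂₉ B₃ B₃' a₀ a₁).ν P.K (hd3 P) (h0 P)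
      (Z := Z P) (Λ := Λ P) (k := k P) (M := M P) (hk0 := hk0 P) (hk := hk P) (eR₀ := eR₀ P) (heR₀ := heR₀ P) (T := T P) (lo := lo P) (hi := hi P) (n := n P) (hn := hn P)
      (hN := hN P) (hbox := hbox P) (hZ := hZ P) (hTG0 := hTG0 P) (hN5 := hN5 P) (ext := ext P) (hext := hext P) (hlohi := hlohi P)
      (LO := LO P) (HI := HI P) (hLO := hLO P) (hHI := hHI P) (n' := n' P) (hn' := hn' P) (hn'N := hn'N P) (hR' := hR' P)
      (hbx := hbx P) (hbxM := hbxM P) (hM := hM P) (hR := hR P) (hMin := hMin P)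
      (h𝓐₀ := h𝓐₀ P) (N := N P) (hNpos := hNpos P)
      (path := path P) (root := root P) (hF2 := hF2 P) (hwalk := hwalk P) (hpkg := hpkg P) (hcov := hcov P)
      (ℓs := ℓs P) (hℓs := hℓs P) (ℓb := ℓb P) (ℓ := ℓ P) (ℓT := ℓT P) (hcapS := hcapS P) (hcapB := hcapB P) (hNcap := hNcap P) (hGN := hGN P) (hN1 := hN1 P)
      (e₀ := e₀ P) (cP := cP P) (cT := cT P) (cG := cG P) (he₀ := he₀ P) (hcP := hcP P) (hcT := hcT P) (hcG := hcG P) (S := S P) (hP := hP P) (hSΩ := hSΩ P) (hT := hT P)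
      (hΩw := hΩw P)
      (hfar := fun i b hb => far_letter_of_box (hbox P i) (hZ1 P i) b hb) (hZblk := hZblk P) (hdiv := hdiv P)
      (hM2 := h2) (hB₃ := hB) (ha₁' := ha₁) (hεreg := ha₀) (ha₀ := le_of_eq rfl)
      (h15T := thm1TorusClass_of_variationalThm1RegSepCoP7M (theta13OfThm1CCMW F 2 j γ ε₀ ε₂₉ B₃ B₃' a₀ a₁).ν P.K h15)
  -- 12Zᴳ-W §2 at the LF-pinned base layer, its Prop-1 row fed
  exact exists_gamma_residW_b15Leaf_window_theta13OfThm1CCMW_topLevel_pinnedΛΩχZ_of_massLive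
    { lam with LF := fun P => lfVarOn su2Chart fun i => InstOn.std (Node00.bgMSCoPOfRecord F 2 (theta13OfThm1CCMW F 2 j γ ε₀ ε₂₉ B₃ B₃' a₀ a₁).ν P.K (k P i) (maxDomT (theta13OfThm1CCMW F 2 j γ ε₀ ε₂₉ B₃ B₃' a₀ a₁).ν.M₁ (Z P i))) (theta13OfThm1CCMW F 2 j γ ε₀ ε₂₉ B₃ B₃' a₀ a₁).ν.M₁ (Z P i) (Λ P i) (k P i) (M P i) (areg P i) (anExt (pts (k P i) (Λ P i)) (T P i) (fun177std (Node00.bgMSCoPOfRecord F 2 (theta13OfThm1CCMW F 2 j γ ε₀ ε₂₉ B₃ B₃' a₀ a₁).ν P.K (k P i) (maxDomT (theta13OfThm1CCMW F 2 j γ ε₀ ε₂₉ B₃ B₃' a₀ a₁).ν.M₁ (Z P i))) (theta13OfThm1CCMW F 2 j γ ε₀ ε₂₉ B₃ B₃' a₀ a₁).ν.M₁ (Z P i) (k P i)) (ext P i) (min (1 / 2) (min (R P i / 8) (((12 * ((F.P P.K).d : ℝ)) ^ 2 / (10 * bx P ^ 2)) / (M P i) ^ 5 * (R P i / 2) ^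 2 / (48 * (4 * ((Fintype.card (Plaq (F.P P.K) 0) : ℝ) * (1 + 8 * 𝓐₀ P i ^ 4)) / R P i + 1)))))) }
    σ s Nm p₁ hγ₀ hγh hB hB' ha₀ ha₁ hbox' hβ' hγe D hD hmassLive (fun P _ _ => hP P) hNN hNk hβ0 hβ hL₀ hL₀L hOB hδ hC hβhist hMl hΛ L91h L95 L91 L97 L80

end WindowRoadPinLF

end Summit.QuantumFields.YangMills.BalabanUVNodes.N12AtTheta13OfThm1CCMWGenericDoorWindowGuardPinLFAssembledForestPackageLocChartLetterN

end
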